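import Literature.Probability.Percolation.FKLoopNestingTestFunctions
import HarnessLib

/-!
# DKLM 2026, Corollary 10: the bound on `cos_μ`, the zero test function, densities

Continuation of `FKLoopNestingTestFunctions` for the named fact
`Literature.Probability.Percolation.dklm2026_corollary10` (Duminil-Copin–Kozlowski–Lammers–
Manolescu, arXiv:2603.06268, Cor. 10, vendored in `FKLoopNestingGaussianLimit`):

* **`cos_μ`** (§3.2): `cos_μ x = cos x - tan(2πμ) sin x` and `|cos_μ x| ≤ 2/√q` for `0 < q ≤ 4`
  (the loop weight is bounded, though larger than `1` in absolute value for `q < 4`).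
* **The zero test function** is admissible and Cor. 10 holds for it outright (both sides equal `1`:
  `cos_μ(0) = 1`, `exp 0 = 1`) — a consistency check of the normalisations
  (`tendsto_integral_loopNestingWeight_zero`).
* **The interior of a loop is open** (`isOpen_loopInterior`, hence Borel): the winding number of
  a planar loop is locally constant off its trace (`Curve.wind_eq_wind_of_dist_lt`, by translating
  the loop and `Curve.wind_eq_of_dist_toContinuousMap_lt`) and vanishes on it. Consequently
  `(f · Leb)(int u) = ∫_{W(u,·) ≠ 0} f` (`withDensityᵥ_loopInterior`).
* **Cor. 10 for densities** (`dklm2026_corollary10.density`, `.density_one`): from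
  `(h : dklm2026_corollary10)`, for `f` measurable, `|f| ≤ C`, `f = 0` off `B̄(0,R)`, `∫ f = 0`:
  `E_P[∏_u cos_μ(∫_{int u} f)] → exp((σ²/4π) ∫∫ log ‖x - y‖ f(x) f(y) dy dx)`, and at `q = 1`
  `E_P[∏_u 2cos(∫_{W(u,·)≠0} f + π/3)] → exp((3/4π²) ∫∫ log ‖x - y‖ f f)` — literally the shape of
  the consumer crux `MagicFormulaZ2` of `Summits/CriticalPhenomena/CardyFormulaZ2/Theses/
  CardyMagicRigidity`, up to the identification of `P` with `bondPercolation (zdGraph 2) half`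
  (the tree's unproved `rcMeasure_one_eq_bondPercolation` plus cylinder convergence), which is not
  done here.

## References

* H. Duminil-Copin, K. K. Kozlowski, P. Lammers, I. Manolescu, arXiv:2603.06268 (2026): §3.2
  (`μ`, `cos_μ`, `int(ℓ)`), (5.4), Cor. 10.
* W. Fulton, *Algebraic Topology: A First Course* (1995), §3 (winding numbers are locally constant).
-/

noncomputable section

open MeasureTheory Set Filter Metric
open scoped ENNReal Real Topology

namespace Literature.Probability.Percolation

open LatticeModels RandomPlanarGeometry

/-! ### `cos_μ` -/

/-- `√q ≤ 2` for `q ≤ 4`. [folklore] -/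
theorem sqrt_le_two_of_le_four {q : ℝ} (hq : q ≤ 4) : Real.sqrt q ≤ 2 := by
  rw [show (2 : ℝ) = Real.sqrt 4 by
    rw [show (4 : ℝ) = 2 ^ 2 by norm_num, Real.sqrt_sq (by norm_num : (0 : ℝ) ≤ 2)]]
  exact Real.sqrt_le_sqrt hq

/-- `cos(2πμ) = √q/2 > 0` for `0 < q ≤ 4`. [cite: DuminilCopinKozlowskiLammersManolescu2026, §3.2] -/
theorem cos_two_pi_mul_dklmMu_pos {q : ℝ} (hq0 : 0 < q) (hq : q ≤ 4) :
    0 < Real.cos (2 * π * dklmMu q) := by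
  rw [cos_two_pi_mul_dklmMu hq]
  exact div_pos (Real.sqrt_pos.2 hq0) two_pos

/-- `cos_μ(x) = cos x - tan(2πμ) sin x` for `0 < q ≤ 4` (addition formula).
[cite: DuminilCopinKozlowskiLammersManolescu2026, §3.2] -/
theorem cosMu_eq_cos_sub_tan_mul_sin {q : ℝ} (hq0 : 0 < q) (hq : q ≤ 4) (x : ℝ) :
    cosMu q x = Real.cos x - Real.tan (2 * π * dklmMu q) * Real.sin x := by
  have hc : Real.cos (2 * π * dklmMu q) ≠ 0 := (cos_two_pi_mul_dklmMu_pos hq0 hq).ne'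
  rw [cosMu, Real.cos_add, Real.tan_eq_sin_div_cos]
  field_simp

/-- The loop weight is bounded: `|cos_μ(x)| ≤ 2/√q` for `0 < q ≤ 4` (since `cos(2πμ) = √q/2`).
[cite: DuminilCopinKozlowskiLammersManolescu2026, §3.2] -/
theorem abs_cosMu_le {q : ℝ} (hq0 : 0 < q) (hq : q ≤ 4) (x : ℝ) :
    |cosMu q x| ≤ 2 / Real.sqrt q := by
  have hs : 0 < Real.sqrt q := Real.sqrt_pos.2 hq0
  rw [cosMu, cos_two_pi_mul_dklmMu hq, abs_div, abs_of_pos (div_pos hs two_pos), div_div_eq_mul_div,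
    div_le_div_iff_of_pos_right hs]
  have := Real.abs_cos_le_one (x + 2 * π * dklmMu q)
  linarith

/-! ### The zero test function -/

/-- The zero measure is a generalised test function. [cite: DuminilCopinKozlowskiLammersManolescu2026, Def. 5] -/
theorem isGeneralisedTestFunction_zero : IsGeneralisedTestFunction 0 :=
  ⟨⟨0, by simp [SignedMeasure.totalVariation_zero]⟩, by simp⟩

/-- The zero measure has finite Dirichlet energy. [cite: DuminilCopinKozlowskiLammersManolescu2026, Def. 6(ii)] -/
theorem hasFiniteDirichletEnergy_zero : HasFiniteDirichletEnergy 0 := by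
  refine ⟨fun x ↦ by simp [SignedMeasure.totalVariation_zero], ?_⟩
  rw [SignedMeasure.totalVariation_zero, Measure.zero_prod]
  exact integrable_zero_measure

/-- `∫ f d0 = 0`. [folklore] -/
@[simp] theorem signedIntegral_zero_measure (f : ℂ → ℝ) : signedIntegral 0 f = 0 := by
  simp [signedIntegral, SignedMeasure.toJordanDecomposition_zero, JordanDecomposition.zero_posPart,
    JordanDecomposition.zero_negPart]

/-- The zero measure has Dirichlet energy `0`. [cite: DuminilCopinKozlowskiLammersManolescu2026, Def. 6(ii)] -/
@[simp] theorem dirichletEnergy_zero : dirichletEnergy 0 = 0 :=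
  signedIntegral_zero_measure _

/-- For the zero test function every loop weighs `cos_μ(0) = 1`, so `∏_ℓ cos_μ(0(int ℓ)) = 1`.
[cite: DuminilCopinKozlowskiLammersManolescu2026, §3.2] -/
theorem loopNestingWeight_zero_measure {q : ℝ} (hq0 : 0 < q) (hq : q ≤ 4) (δ : ℝ)
    (ω : BondConfig (Site 2)) : loopNestingWeight q 0 δ ω = 1 := by
  have h0 : ∀ u : UnbasedLoop ℂ, cosMu q ((0 : SignedMeasure ℂ) (loopInterior u)) = 1 := fun u ↦ by
    rw [show (0 : SignedMeasure ℂ) (loopInterior u) = 0 from rfl, cosMu_zero hq0 hq]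
  simp only [loopNestingWeight, h0]
  exact finprod_mem_one _

/-- **Cor. 10 for the zero test function** (consistency of the normalisations): for `φ = 0` both
sides equal `1`, for every probability measure `P` and every `q ∈ [1, 4]`.
[cite: DuminilCopinKozlowskiLammersManolescu2026, Cor. 10] -/
theorem tendsto_integral_loopNestingWeight_zero {q : ℝ} (hq : q ∈ Set.Icc (1 : ℝ) 4)
    (P : Measure (BondConfig (Site 2))) [IsProbabilityMeasure P] :
    Tendsto (fun δ : ℝ ↦ ∫ ω, loopNestingWeight q 0 δ ω ∂P) (𝓝[>] 0)
      (𝓝 (Real.exp (-(dklmSigmaSq q / 2) * dirichletEnergy 0))) := by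
  have h1 : (fun δ : ℝ ↦ ∫ ω, loopNestingWeight q 0 δ ω ∂P) = fun _ ↦ 1 := by
    funext δ
    simp [loopNestingWeight_zero_measure (by linarith [hq.1]) hq.2]
  rw [h1, dirichletEnergy_zero, mul_zero, Real.exp_zero]
  exact tendsto_const_nhds

/-! ### The interior of a loop is open (hence Borel) -/

/-- **The winding number is locally constant off the trace**: if `dist w z < dist(z, trace γ)` then
`W(γ, w) = W(γ, z)` — translate the loop by `z - w` (`Curve.wind_map_affine`) and use the stability
of the winding number under perturbations of the loop smaller than the distance to the trace
(`Curve.wind_eq_of_dist_toContinuousMap_lt`). Deliberate dot-notation extension of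
`Literature.Probability.RandomPlanarGeometry.Curve` (`LoopWinding`). [folklore] -/
theorem _root_.Literature.Probability.RandomPlanarGeometry.Curve.wind_eq_wind_of_dist_lt
    (γ : Curve ℂ) {z w : ℂ} (h : dist w z < Metric.infDist z γ.range) : γ.wind w = γ.wind z := by
  by_cases hγ : γ.IsLoop
  swap
  · rw [Curve.wind_of_not_isLoop hγ, Curve.wind_of_not_isLoop hγ]
  set b : ℂ := z - w with hb
  set f : C(ℂ, ℂ) := ⟨fun x ↦ 1 * x + b, by fun_prop⟩ with hf
  have hγ' : (γ.map f).IsLoop := by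
    rw [Curve.isLoop_iff, Curve.source_def, Curve.target_def] at hγ ⊢
    simp only [Curve.map_apply, hγ]
  have h1 : (γ.map f).wind (1 * w + b) = γ.wind w := Curve.wind_map_affine γ one_ne_zero b w
  have hwz : 1 * w + b = z := by rw [hb]; ring
  rw [hwz] at h1
  rw [← h1]
  refine Curve.wind_eq_of_dist_toContinuousMap_lt hγ hγ' (lt_of_le_of_lt ?_ h)
  refine (ContinuousMap.dist_le dist_nonneg).2 fun t ↦ ?_
  show dist (γ t) (1 * γ t + b) ≤ dist w z
  rw [dist_eq_norm, dist_eq_norm, hb]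
  apply le_of_eq
  rw [show γ t - (1 * γ t + (z - w)) = w - z by ring]

/-- **`{z | W(γ, z) ≠ 0}` is open**: it avoids the (closed) trace, where `W = 0` by convention, and
`W(γ, ·)` is locally constant off the trace. Deliberate dot-notation extension of
`Literature.Probability.RandomPlanarGeometry.Curve`. [folklore] -/
theorem _root_.Literature.Probability.RandomPlanarGeometry.Curve.isOpen_setOf_wind_ne_zero
    (γ : Curve ℂ) : IsOpen {z | γ.wind z ≠ 0} := by
  rw [Metric.isOpen_iff]
  intro z hz
  have hzr : z ∉ γ.range := fun h ↦ hz (Curve.wind_of_mem_range h)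
  refine ⟨Metric.infDist z γ.range,
    (γ.isCompact_range.isClosed.notMem_iff_infDist_pos γ.range_nonempty).1 hzr, fun w hw ↦ ?_⟩
  simp only [mem_setOf_eq] at hz ⊢
  rwa [γ.wind_eq_wind_of_dist_lt (Metric.mem_ball.1 hw)]

/-- `{z | W(c, z) ≠ 0}` is open for a curve class `c`. Deliberate dot-notation extension of
`Literature.Probability.RandomPlanarGeometry.CurveClass`. [folklore] -/
theorem _root_.Literature.Probability.RandomPlanarGeometry.CurveClass.isOpen_setOf_wind_ne_zero
    (c : CurveClass ℂ) : IsOpen {z | c.wind z ≠ 0} := by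
  obtain ⟨γ, rfl⟩ := CurveClass.surjective_mk c
  simpa only [CurveClass.wind_mk] using γ.isOpen_setOf_wind_ne_zero

/-- `{z | W(u, z) ≠ 0}` is open for an unbased loop `u`. Deliberate dot-notation extension of
`Literature.Probability.RandomPlanarGeometry.UnbasedLoop`. [folklore] -/
theorem _root_.Literature.Probability.RandomPlanarGeometry.UnbasedLoop.isOpen_setOf_wind_ne_zero
    (u : UnbasedLoop ℂ) : IsOpen {z | u.wind z ≠ 0} := by
  obtain ⟨ℓ, rfl⟩ := UnbasedLoop.mk_surjective u
  simpa only [UnbasedLoop.wind_mk] using ℓ.toCurveClass.isOpen_setOf_wind_ne_zero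

/-- The interior `int(u) = {W(u, ·) ≠ 0}` of a loop is open.
[cite: DuminilCopinKozlowskiLammersManolescu2026, §3.2 (int(ℓ))] -/
theorem isOpen_loopInterior (u : UnbasedLoop ℂ) : IsOpen (loopInterior u) :=
  u.isOpen_setOf_wind_ne_zero

/-- The interior of a loop is a Borel set. [cite: DuminilCopinKozlowskiLammersManolescu2026, §3.2 (int(ℓ))] -/
theorem measurableSet_loopInterior (u : UnbasedLoop ℂ) : MeasurableSet (loopInterior u) :=
  (isOpen_loopInterior u).measurableSet

/-! ### Cor. 10 for densities -/

section DensityCorollary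

variable {f : ℂ → ℝ} {R C : ℝ}

/-- `(f · Leb)(int u) = ∫_{W(u,·) ≠ 0} f`. [cite: DuminilCopinKozlowskiLammersManolescu2026, §3.2] -/
theorem withDensityᵥ_loopInterior (hfi : Integrable f volume) (u : UnbasedLoop ℂ) :
    ((volume : Measure ℂ).withDensityᵥ f) (loopInterior u) = ∫ z in {z | u.wind z ≠ 0}, f z :=
  withDensityᵥ_apply hfi (measurableSet_loopInterior u)

/-- The nesting weight of a density: `∏_u cos_μ(∫_{int u} f)`.
[cite: DuminilCopinKozlowskiLammersManolescu2026, §3.2 and (5.4)] -/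
theorem loopNestingWeight_withDensityᵥ (q : ℝ) (hfi : Integrable f volume) (δ : ℝ)
    (ω : BondConfig (Site 2)) :
    loopNestingWeight q ((volume : Measure ℂ).withDensityᵥ f) δ ω =
      ∏ᶠ u ∈ (bondLoopConfig δ 0 ω).F 0 ∪ (bondLoopConfig δ 0 ω).F 1,
        cosMu q (∫ z in {z | u.wind z ≠ 0}, f z) := by
  simp only [loopNestingWeight, withDensityᵥ_loopInterior hfi]

/-- **Cor. 10 for densities** (consequence of the named fact): for `q ∈ [1, 4]`, a free
random-cluster limit `P` at the self-dual point, and a measurable `f` with `|f| ≤ C`, `f = 0`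
outside `B̄(0, R)` and `∫ f = 0`,
`E_P[∏_u cos_μ(∫_{int u} f)] → exp((σ²/4π) ∫∫ log ‖x - y‖ f(x) f(y) dy dx)` as `δ → 0⁺`
(`-½σ² · (-1/2π) = σ²/4π`). [cite: DuminilCopinKozlowskiLammersManolescu2026, Cor. 10] -/
theorem dklm2026_corollary10.density (h : dklm2026_corollary10) {q : ℝ} (hq : q ∈ Set.Icc (1 : ℝ) 4)
    {P : Measure (BondConfig (Site 2))} (hP : IsFreeRandomClusterLimit (rcSelfDualPoint q) q P)
    (hf : Measurable f) (hC : ∀ z, |f z| ≤ C) (hR : ∀ z, R < ‖z‖ → f z = 0) (h0 : ∫ z, f z = 0) :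
    Tendsto
      (fun δ : ℝ ↦ ∫ ω, (∏ᶠ u ∈ (bondLoopConfig δ 0 ω).F 0 ∪ (bondLoopConfig δ 0 ω).F 1,
        cosMu q (∫ z in {z | u.wind z ≠ 0}, f z)) ∂P)
      (𝓝[>] 0)
      (𝓝 (Real.exp (dklmSigmaSq q / (4 * π) * ∫ x, ∫ y, Real.log ‖x - y‖ * f x * f y))) := by
  have hfi := integrable_of_abs_le_of_eq_zero hf hC hR
  have h1 := h q hq P hP _ (isGeneralisedTestFunction_withDensityᵥ hf hfi hR h0)
    (hasFiniteDirichletEnergy_withDensityᵥ hf hC hR)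
  simp only [loopNestingWeight_withDensityᵥ q hfi, dirichletEnergy_withDensityᵥ hf hC hR] at h1
  convert h1 using 3
  field_simp
  ring

/-- **Cor. 10 for densities at `q = 1`** (critical bond percolation, the shape of the consumer
statement `MagicFormulaZ2` of `CardyMagicRigidity`): for every free random-cluster limit `P` at
`(p, q) = (1/2, 1)` and `f` as above,
`E_P[∏_u 2cos(∫_{W(u,·)≠0} f + π/3)] → exp((3/4π²) ∫∫ log ‖x - y‖ f(x) f(y) dy dx)`.
[cite: DuminilCopinKozlowskiLammersManolescu2026, Cor. 10 (q = 1)] -/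
theorem dklm2026_corollary10.density_one (h : dklm2026_corollary10)
    {P : Measure (BondConfig (Site 2))} (hP : IsFreeRandomClusterLimit (1 / 2) 1 P)
    (hf : Measurable f) (hC : ∀ z, |f z| ≤ C) (hR : ∀ z, R < ‖z‖ → f z = 0) (h0 : ∫ z, f z = 0) :
    Tendsto
      (fun δ : ℝ ↦ ∫ ω, (∏ᶠ u ∈ (bondLoopConfig δ 0 ω).F 0 ∪ (bondLoopConfig δ 0 ω).F 1,
        2 * Real.cos ((∫ z in {z | u.wind z ≠ 0}, f z) + π / 3)) ∂P)
      (𝓝[>] 0)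
      (𝓝 (Real.exp (3 / (4 * π ^ 2) * ∫ x, ∫ y, Real.log ‖x - y‖ * f x * f y))) := by
  have h1 := dklm2026_corollary10.density h (q := 1) ⟨le_rfl, by norm_num⟩ (by rwa [rcSelfDualPoint_one])
    hf hC hR h0
  simp only [cosMu_one, dklmSigmaSq_one] at h1
  convert h1 using 3
  field_simp

end DensityCorollary

end Literature.Probability.Percolation

end
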